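import Summits.CriticalPhenomena.PercolationContinuityZ3.Theorems.PercShatteringRaceNearLinearTwoClusterDecayStubCritTwoArmImprovedAux
import HarnessLib

/-!
# Crux `PercShatteringRace.NearLinearTwoClusterDecay` (stmt-CriticalPhenomena-5785) — frontier stub W2
# `stub_critTwoArmImproved`: bond Cerf 2015 Theorem 1.1 AT `p_c(ℤ³)`, unconditional, qualitative form

Helper file of the line `pair-decay-long-arms-dense`; lands with `--supports stmt-CriticalPhenomena-5785`
(registered stub `stub_critTwoArmImproved`), sequel of `…StubCritTwoArmImprovedAux.lean`.

## Statement

If `P_{p_c}(a ↔ b inside Λ_{2n}) ≥ c n^{-12}` for all `a, b ∈ Λ_n`, `n ≥ 1` (the W1 input of the line),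
then the edge two-arms probability of critical bond percolation on `ℤ³` decays with an exponent STRICTLY
above `1/2`: `∃ κ > 1/2, ∃ C, ∀ i, ∀ m ≥ 1, P_{p_c}(edgeTwoArms i m) ≤ C m^{-κ}` (here `κ = 1/2 + 1/112`).

## Proof sketch

* `real_edgeTwoArms_dyadic_le_crit`: Cerf's §9 iteration along the dyadic scales
  `n_s = (2·2^s+1) 2^{55 s} + 2^s` — proof = `Cerf2015BoxLRO16.real_edgeTwoArms_dyadic_le` verbatim, the
  §8 inequality now `cube_mul_real_edgeTwoArms_le_crit` (pair-connection input instead of `θ(p) > 0`),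
  the AKN seed `AKN.exists_real_edgeTwoArms_le` unchanged: `P_p(edgeTwoArms i (3 n_s)) √n_s (√2)^s ≤ C`.
* `real_edgeTwoArms_le_rpow`: exponent extraction. For `m ≥ 3 n_1` pick the window
  `3 n_s ≤ m ≤ 3 n_{s+1}` (`Cerf2015BoxLRO16.exists_window`); monotonicity in the scale
  (`Cerf2015BoxLRO16.real_edgeTwoArms_anti`) gives `P(edgeTwoArms i m) ≤ C/(√n_s (√2)^s)`;
  `m ≤ 3 n_{s+1} ≤ 3·2^{57} n_s` gives `√m ≤ √3 √(2^{57}) √n_s`, and `m ≤ 2^{61} 2^{56 s}` gives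
  `m^{1/112} ≤ (2^{61})^{1/112} (√2)^s`; so `P m^{1/2+1/112} ≤ C √3 √(2^{57}) (2^{61})^{1/112}`.  Small `m`
  by `P ≤ 1`.
* `stub_critTwoArmImproved`: `p = p_c(ℤ³)`, `0 < p_c < 1` by `Grimmett1999_criticalProb_pos_lt_one_holds`.

## References

* R. Cerf, *A lower bound on the two-arms exponent for critical percolation on the lattice*, Ann.
  Probab. 43 (2015) 2458–2480, arXiv:1306.3105, Theorem 1.1 and §9 [Cerf2015].
-/

noncomputable section

namespace Summit.CriticalPhenomena.PercolationContinuityZ3.Theorems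

open Literature.Probability.Percolation Literature.Probability.Percolation.AKN
  Literature.Probability.Percolation.GM Literature.Probability.LatticeModels MeasureTheory Finset Real
open scoped Classical
open Cerf2015BoxLRO16

namespace NearLinearTwoClusterDecayCritTwoArm

/-- **Cerf 2015, §9, one iteration step, bond version on `ℤ³` along the dyadic scales
`n_s = (2·2^s + 1) 2^{55 s} + 2^s`, from a polynomial pair-connection lower bound in place of
`θ(p) > 0`**: for `0 < p < 1` and `c > 0` with `P_p(a ↔ b inside Λ_{2n}) ≥ c n^{-12}` on `Λ_n²` (`n ≥ 1`)
there is `C` with `P_p(edgeTwoArms i (3 n_s)) √n_s (√2)^s ≤ C` for all `s ≥ 1` (proof =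
`Cerf2015BoxLRO16.real_edgeTwoArms_dyadic_le`, the §8 inequality now
`cube_mul_real_edgeTwoArms_le_crit`). [cite: Cerf2015, §9] -/
theorem real_edgeTwoArms_dyadic_le_crit (p : unitInterval) (hp0 : 0 < (p : ℝ)) (hp1 : (p : ℝ) < 1)
    {c : ℝ} (hc : 0 < c)
    (hW : ∀ n : ℕ, 1 ≤ n → ∀ a ∈ box 3 n, ∀ b ∈ box 3 n,
      c * (n : ℝ) ^ (-(12 : ℝ)) ≤
        (bondPercolation (zdGraph 3) p).real (openConnIn (↑(box 3 (2 * n)) : Set (Site 3)) a b)) :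
    ∃ C : ℝ, ∀ (s n : ℕ), 1 ≤ s → n = (2 * 2 ^ s + 1) * 2 ^ (55 * s) + 2 ^ s → ∀ i : Fin 3,
      (bondPercolation (zdGraph 3) p).real (edgeTwoArms i (3 * n)) * Real.sqrt n * Real.sqrt 2 ^ s ≤ C := by
  obtain ⟨A, hA0, hA⟩ := cube_mul_real_edgeTwoArms_le_crit p hp0 hp1 hc hW
  -- the AKN input, uniformly on `[δ, 1-δ] ∋ p`
  have h1p : 0 < 1 - (p : ℝ) := by linarith
  obtain ⟨δ, hδ⟩ : ∃ δ : ℝ, δ = min (min (p : ℝ) (1 - p)) (1 / 2) := ⟨_, rfl⟩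
  have hδ0 : 0 < δ := by rw [hδ]; exact lt_min (lt_min hp0 h1p) (by norm_num)
  have hδ2 : δ ≤ 1 / 2 := by rw [hδ]; exact min_le_right _ _
  have hδp : δ ≤ p := by rw [hδ]; exact (min_le_left _ _).trans (min_le_left _ _)
  have hδp' : (p : ℝ) ≤ 1 - δ := by
    have : δ ≤ 1 - p := by rw [hδ]; exact (min_le_left _ _).trans (min_le_right _ _)
    linarith
  obtain ⟨κ, hκ0, hκ⟩ := exists_real_edgeTwoArms_le (d := 3) (by norm_num) hδ0 hδ2
  -- constants
  obtain ⟨c₀, hc₀⟩ : ∃ c₀ : ℝ, c₀ = 2 * (p : ℝ) ^ 2 * (1 - p) ^ 2 := ⟨_, rfl⟩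
  have hc₀0 : 0 < c₀ := by rw [hc₀]; positivity
  obtain ⟨A₃, hA₃⟩ : ∃ A₃ : ℝ, A₃ = 189 + A * (171 * κ) := ⟨_, rfl⟩
  have hA₃0 : 0 ≤ A₃ := by rw [hA₃]; positivity
  refine ⟨12 / Real.sqrt c₀ * A₃ + 144 / p, ?_⟩
  intro s n hs hn i
  -- the integers `K = 2^s`, `J = 2^{55 s}`, `P = J K = 2^{56 s}`
  obtain ⟨K, hK⟩ : ∃ K : ℕ, K = 2 ^ s := ⟨_, rfl⟩
  obtain ⟨J, hJ⟩ : ∃ J : ℕ, J = 2 ^ (55 * s) := ⟨_, rfl⟩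
  obtain ⟨P, hP⟩ : ∃ P : ℕ, P = 2 ^ (56 * s) := ⟨_, rfl⟩
  have hPJK : P = J * K := by rw [hP, hJ, hK, ← pow_add]; congr 1; ring
  have hK2 : 2 ≤ K := by
    rw [hK]
    calc 2 = 2 ^ 1 := rfl
      _ ≤ 2 ^ s := Nat.pow_le_pow_right (by norm_num) hs
  have hJ2 : 2 ≤ J := by
    rw [hJ]
    calc 2 = 2 ^ 1 := rfl
      _ ≤ 2 ^ (55 * s) := Nat.pow_le_pow_right (by norm_num) (by omega)
  have hP2J : 2 * J ≤ P := by rw [hPJK]; nlinarith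
  have hP2K : 2 * K ≤ P := by rw [hPJK]; nlinarith
  have hnP : n = 2 * P + J + K := by rw [hn, hPJK, hK, hJ]; ring
  have hn1 : 1 ≤ n := by omega
  have hKn : K + 3 ≤ n := by omega
  have hPle : P ≤ n - K - 2 := by omega
  have hP1 : 1 ≤ P := by omega
  -- real versions
  have hKr : (K : ℝ) = 2 ^ s := by rw [hK]; push_cast; ring
  have hPr : (P : ℝ) = 2 ^ (56 * s) := by rw [hP]; push_cast; ring
  have hK0 : (0 : ℝ) < K := by rw [hKr]; positivity
  have hP0 : (0 : ℝ) < P := by rw [hPr]; positivity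
  have hn0 : (0 : ℝ) < n := by exact_mod_cast hn1
  have hnr1 : (1 : ℝ) ≤ n := by exact_mod_cast hn1
  have h2JK : 2 * ((J : ℝ) * K) ≤ n := by
    have : 2 * (J * K) ≤ n := by rw [← hPJK]; omega
    exact_mod_cast this
  have hKlen : (K : ℝ) ≤ n := by
    have : K ≤ n := by omega
    exact_mod_cast this
  have hX8P : 2 * (n : ℝ) + 1 ≤ 8 * P := by
    have : 2 * n + 1 ≤ 8 * P := by omega
    exact_mod_cast this
  -- Step B4 at these parameters
  obtain ⟨X, hX⟩ : ∃ X : ℝ, X = 2 * (n : ℝ) + 1 := ⟨_, rfl⟩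
  have hX1 : 1 ≤ X := by rw [hX]; linarith
  have hX0 : 0 < X := by linarith
  have hlogX0 : 0 ≤ Real.log X := Real.log_nonneg hX1
  obtain ⟨t, ht⟩ : ∃ t : ℝ, t = Real.sqrt (10 * Real.log X / c₀) := ⟨_, rfl⟩
  have ht0 : 0 ≤ t := by rw [ht]; exact Real.sqrt_nonneg _
  have htsq : t ^ 2 = 10 * Real.log X / c₀ := by rw [ht, Real.sq_sqrt (by positivity)]
  have hB4 := hA i K J n (by omega) (by omega) (by rw [hnP, hPJK]; ring) hKn t ht0
  -- the exponential factor is `X^{-10}`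
  have hexp : Real.exp (-2 * (p : ℝ) ^ 2 * (1 - p) ^ 2 * t ^ 2) = (X ^ 10)⁻¹ := by
    have h1 : -2 * (p : ℝ) ^ 2 * (1 - p) ^ 2 * t ^ 2 = -(Real.log (X ^ 10)) := by
      rw [htsq, Real.log_pow, hc₀]; push_cast; field_simp
    rw [h1, Real.exp_neg, Real.exp_log (by positivity)]
  rw [hexp, ← hX] at hB4
  -- the two-arms input at scale `P`: `K^27 T ≤ 120 κ`
  obtain ⟨T, hT⟩ : ∃ T : ℝ, T = ∑ i' : Fin 3, (bondPercolation (zdGraph 3) p).real (edgeTwoArms i' (n - K - 2)) := ⟨_, rfl⟩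
  rw [← hT] at hB4
  have hT0 : 0 ≤ T := by rw [hT]; exact Finset.sum_nonneg fun _ _ => measureReal_nonneg
  have hTle : T ≤ 3 * (κ * (1 + Real.log P) / Real.sqrt P) := by
    rw [hT]
    calc ∑ i' : Fin 3, (bondPercolation (zdGraph 3) p).real (edgeTwoArms i' (n - K - 2))
        ≤ ∑ i' : Fin 3, (bondPercolation (zdGraph 3) p).real (edgeTwoArms i' P) :=
          Finset.sum_le_sum fun i' _ => real_edgeTwoArms_anti p i' hP1 hPle
      _ ≤ ∑ _i' : Fin 3, κ * (1 + Real.log P) / Real.sqrt P :=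
          Finset.sum_le_sum fun i' _ => hκ p hδp hδp' i' P hP1
      _ = 3 * (κ * (1 + Real.log P) / Real.sqrt P) := by
          rw [Finset.sum_const, Finset.card_univ, Fintype.card_fin, nsmul_eq_mul]; push_cast; ring
  have hlogP : Real.log P = (56 * s : ℕ) * Real.log 2 := by rw [hPr, Real.log_pow]
  have hsqrtP : Real.sqrt P = 2 ^ (28 * s) := by
    rw [hPr, show (2 : ℝ) ^ (56 * s) = (2 ^ (28 * s)) ^ 2 by rw [← pow_mul]; congr 1; ring, Real.sqrt_sq (by positivity)]
  have hs1 : (s : ℝ) + 1 ≤ 2 ^ s := succ_le_two_pow_real s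
  have hs0 : (0 : ℝ) ≤ s := Nat.cast_nonneg s
  have hlog2 := log_two_le_one
  have hlog20 : 0 ≤ Real.log 2 := Real.log_nonneg one_le_two
  have hKT : (K : ℝ) ^ 27 * T ≤ 171 * κ := by
    have h1 : (K : ℝ) ^ 27 / Real.sqrt P = ((2 : ℝ) ^ s)⁻¹ := by
      rw [hsqrtP, hKr, ← pow_mul, show 28 * s = s * 27 + s by ring, pow_add]
      field_simp
    have h2 : 1 + Real.log P ≤ 57 * ((s : ℝ) + 1) := by
      rw [hlogP]
      have h56 : ((56 * s : ℕ) : ℝ) * Real.log 2 ≤ ((56 * s : ℕ) : ℝ) * 1 :=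
        mul_le_mul_of_nonneg_left hlog2 (Nat.cast_nonneg _)
      push_cast at h56 ⊢
      linarith
    have h1pos : 0 ≤ (K : ℝ) ^ 27 / Real.sqrt P := by rw [h1]; positivity
    calc (K : ℝ) ^ 27 * T ≤ (K : ℝ) ^ 27 * (3 * (κ * (1 + Real.log P) / Real.sqrt P)) :=
          mul_le_mul_of_nonneg_left hTle (by positivity)
      _ = 3 * κ * (1 + Real.log P) * ((K : ℝ) ^ 27 / Real.sqrt P) := by ring
      _ ≤ 3 * κ * (57 * ((s : ℝ) + 1)) * ((K : ℝ) ^ 27 / Real.sqrt P) :=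
          mul_le_mul_of_nonneg_right (mul_le_mul_of_nonneg_left h2 (by positivity)) h1pos
      _ = 171 * κ * (((s : ℝ) + 1) * ((2 : ℝ) ^ s)⁻¹) := by rw [h1]; ring
      _ ≤ 171 * κ * 1 := by
          refine mul_le_mul_of_nonneg_left ?_ (by positivity)
          rw [mul_inv_le_iff₀ (by positivity), one_mul]; exact hs1
      _ = 171 * κ := mul_one _
  have hA₃' : 189 + A * (K : ℝ) ^ 27 * T ≤ A₃ := by
    rw [hA₃, mul_assoc]; exact add_le_add le_rfl (mul_le_mul_of_nonneg_left hKT hA0)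
  -- the choice of `t`: `t ≤ 24 (√2)^s / √c₀`
  have hlogX : Real.log X ≤ 56 * ((s : ℝ) + 1) := by
    have h8P : X ≤ (2 : ℝ) ^ (56 * s + 3) := by
      rw [hX, pow_add, ← hPr]; linarith
    have h563 : ((56 * s + 3 : ℕ) : ℝ) * Real.log 2 ≤ ((56 * s + 3 : ℕ) : ℝ) * 1 :=
      mul_le_mul_of_nonneg_left hlog2 (Nat.cast_nonneg _)
    calc Real.log X ≤ Real.log ((2 : ℝ) ^ (56 * s + 3)) := Real.log_le_log hX0 h8P
      _ = ((56 * s + 3 : ℕ) : ℝ) * Real.log 2 := Real.log_pow _ _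
      _ ≤ 56 * ((s : ℝ) + 1) := by push_cast at h563 ⊢; linarith
  have htle : t ≤ 24 * Real.sqrt 2 ^ s / Real.sqrt c₀ := by
    rw [ht, Real.sqrt_le_iff]
    constructor
    · positivity
    · rw [div_pow, mul_pow, Real.sq_sqrt hc₀0.le, ← pow_mul, mul_comm s 2, pow_mul, Real.sq_sqrt zero_le_two]
      refine div_le_div_of_nonneg_right ?_ hc₀0.le
      have h576 : (24 : ℝ) ^ 2 = 576 := by norm_num
      have h2s : (0 : ℝ) ≤ 2 ^ s := by positivity
      rw [h576]
      linarith
  -- assemble: multiply the claim by `n³`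
  have hsq2s : 0 ≤ Real.sqrt 2 ^ s := by positivity
  have hn3 : (0 : ℝ) < (n : ℝ) ^ 3 := by positivity
  rw [← mul_le_mul_iff_of_pos_right hn3]
  have hsqn : Real.sqrt ((n : ℝ) ^ 3) * Real.sqrt n = (n : ℝ) ^ 2 := by
    rw [← Real.sqrt_mul (by positivity), show (n : ℝ) ^ 3 * n = ((n : ℝ) ^ 2) ^ 2 by ring, Real.sqrt_sq (by positivity)]
  -- term 1
  have hterm1 : t * Real.sqrt ((n : ℝ) ^ 3) * J * (189 + A * (K : ℝ) ^ 27 * T) * (Real.sqrt n * Real.sqrt 2 ^ s) ≤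
      12 / Real.sqrt c₀ * A₃ * (n : ℝ) ^ 3 := by
    have hJ0 : (0 : ℝ) ≤ J := Nat.cast_nonneg J
    calc t * Real.sqrt ((n : ℝ) ^ 3) * J * (189 + A * (K : ℝ) ^ 27 * T) * (Real.sqrt n * Real.sqrt 2 ^ s)
        = t * (Real.sqrt ((n : ℝ) ^ 3) * Real.sqrt n) * J * (189 + A * (K : ℝ) ^ 27 * T) * Real.sqrt 2 ^ s := by ring
      _ = t * (n : ℝ) ^ 2 * J * (189 + A * (K : ℝ) ^ 27 * T) * Real.sqrt 2 ^ s := by rw [hsqn]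
      _ ≤ (24 * Real.sqrt 2 ^ s / Real.sqrt c₀) * (n : ℝ) ^ 2 * J * A₃ * Real.sqrt 2 ^ s := by
          have h189 : 0 ≤ 189 + A * (K : ℝ) ^ 27 * T := by positivity
          gcongr
      _ = 24 / Real.sqrt c₀ * A₃ * (n : ℝ) ^ 2 * ((Real.sqrt 2 ^ s * Real.sqrt 2 ^ s) * J) := by ring
      _ = 24 / Real.sqrt c₀ * A₃ * (n : ℝ) ^ 2 * ((J : ℝ) * K) := by rw [sqrt_two_pow_mul_self, ← hKr]; ring
      _ ≤ 24 / Real.sqrt c₀ * A₃ * (n : ℝ) ^ 2 * ((n : ℝ) / 2) :=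
          mul_le_mul_of_nonneg_left (by linarith) (by positivity)
      _ = 12 / Real.sqrt c₀ * A₃ * (n : ℝ) ^ 3 := by ring
  -- term 2
  have hterm2 : 144 / p * X ^ 9 * (X ^ 10)⁻¹ * (Real.sqrt n * Real.sqrt 2 ^ s) ≤ 144 / p * (n : ℝ) ^ 3 := by
    have h1 : 144 / p * X ^ 9 * (X ^ 10)⁻¹ = 144 / p * X⁻¹ := by field_simp
    rw [h1]
    have hsn : Real.sqrt n ≤ n := by
      rw [Real.sqrt_le_iff]
      exact ⟨hn0.le, by rw [sq]; exact le_mul_of_one_le_right hn0.le hnr1⟩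
    have hs2 : Real.sqrt 2 ^ s ≤ (n : ℝ) := by
      calc Real.sqrt 2 ^ s ≤ 2 ^ s := pow_le_pow_left₀ (Real.sqrt_nonneg 2)
            (by rw [Real.sqrt_le_iff]; norm_num) s
        _ = K := hKr.symm
        _ ≤ n := hKlen
    have hXinv : X⁻¹ ≤ 1 := inv_le_one_of_one_le₀ hX1
    calc 144 / p * X⁻¹ * (Real.sqrt n * Real.sqrt 2 ^ s) ≤ 144 / p * 1 * ((n : ℝ) * n) := by
          gcongr
      _ ≤ 144 / p * (n : ℝ) ^ 3 := by
          rw [mul_one]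
          refine mul_le_mul_of_nonneg_left ?_ (by positivity)
          calc (n : ℝ) * n = n * n * 1 := by ring
            _ ≤ n * n * n := mul_le_mul_of_nonneg_left hnr1 (by positivity)
            _ = (n : ℝ) ^ 3 := by ring
  calc (bondPercolation (zdGraph 3) p).real (edgeTwoArms i (3 * n)) * Real.sqrt n * Real.sqrt 2 ^ s * (n : ℝ) ^ 3
      = ((n : ℝ) ^ 3 * (bondPercolation (zdGraph 3) p).real (edgeTwoArms i (3 * n))) * (Real.sqrt n * Real.sqrt 2 ^ s) := by ring
    _ ≤ (t * Real.sqrt ((n : ℝ) ^ 3) * J * (189 + A * (K : ℝ) ^ 27 * T) + 144 / p * X ^ 9 * (X ^ 10)⁻¹) *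
          (Real.sqrt n * Real.sqrt 2 ^ s) := mul_le_mul_of_nonneg_right hB4 (by positivity)
    _ = t * Real.sqrt ((n : ℝ) ^ 3) * J * (189 + A * (K : ℝ) ^ 27 * T) * (Real.sqrt n * Real.sqrt 2 ^ s) +
          144 / p * X ^ 9 * (X ^ 10)⁻¹ * (Real.sqrt n * Real.sqrt 2 ^ s) := by ring
    _ ≤ 12 / Real.sqrt c₀ * A₃ * (n : ℝ) ^ 3 + 144 / p * (n : ℝ) ^ 3 := add_le_add hterm1 hterm2
    _ = (12 / Real.sqrt c₀ * A₃ + 144 / p) * (n : ℝ) ^ 3 := by ring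

/-- `(2^{56 s})^{1/112} = (√2)^s`. [folklore] -/
theorem rpow_two_pow_eq_sqrt_two_pow (s : ℕ) :
    ((2 : ℝ) ^ (56 * s)) ^ (1 / 112 : ℝ) = Real.sqrt 2 ^ s := by
  rw [Real.sqrt_eq_rpow, ← Real.rpow_natCast 2 (56 * s), ← Real.rpow_mul zero_le_two,
    ← Real.rpow_mul_natCast zero_le_two]
  congr 1
  push_cast
  ring

/-- **Exponent extraction** (Cerf 2015, Theorem 1.1, bond version on `ℤ³`, from a polynomial
pair-connection lower bound in place of `θ(p) > 0`): for `0 < p < 1` and `c > 0` with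
`P_p(a ↔ b inside Λ_{2n}) ≥ c n^{-12}` on `Λ_n²` (`n ≥ 1`), there are `κ > 1/2` (namely `1/2 + 1/112`)
and `C` with `P_p(edgeTwoArms i m) ≤ C m^{-κ}` for all `m ≥ 1` and all directions `i` (dyadic bound
`real_edgeTwoArms_dyadic_le_crit`, monotonicity in the scale, windows `[3 n_s, 3 n_{s+1}]`,
`m ≤ 2^{61} 2^{56 s}`). [cite: Cerf2015, Thm 1.1 and §9] -/
theorem real_edgeTwoArms_le_rpow (p : unitInterval) (hp0 : 0 < (p : ℝ)) (hp1 : (p : ℝ) < 1)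
    {c : ℝ} (hc : 0 < c)
    (hW : ∀ n : ℕ, 1 ≤ n → ∀ a ∈ box 3 n, ∀ b ∈ box 3 n,
      c * (n : ℝ) ^ (-(12 : ℝ)) ≤
        (bondPercolation (zdGraph 3) p).real (openConnIn (↑(box 3 (2 * n)) : Set (Site 3)) a b)) :
    ∃ κ : ℝ, 1 / 2 < κ ∧ ∃ C : ℝ, ∀ i : Fin 3, ∀ m : ℕ, 1 ≤ m →
      (bondPercolation (zdGraph 3) p).real (edgeTwoArms i m) ≤ C * (m : ℝ) ^ (-κ) := by
  obtain ⟨C, hC⟩ := real_edgeTwoArms_dyadic_le_crit p hp0 hp1 hc hW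
  -- `C ≥ 0` (instance `s = 1`)
  have hC0 : 0 ≤ C := by
    have h := hC 1 _ le_rfl rfl 0
    exact le_trans (by positivity) h
  obtain ⟨D, hD⟩ : ∃ D : ℝ,
      D = C * (Real.sqrt 3 * Real.sqrt ((2 : ℝ) ^ 57) * ((2 : ℝ) ^ 61) ^ (1 / 112 : ℝ)) := ⟨_, rfl⟩
  have hD0 : 0 ≤ D := by rw [hD]; positivity
  -- the first window starts at `m₀ = 3 n_1`; the exponent
  obtain ⟨m₀, hm₀⟩ : ∃ m₀ : ℕ, m₀ = 3 * ((2 * 2 ^ 1 + 1) * 2 ^ (55 * 1) + 2 ^ 1) := ⟨_, rfl⟩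
  obtain ⟨κ, hκ⟩ : ∃ κ : ℝ, κ = 1 / 2 + 1 / 112 := ⟨_, rfl⟩
  have hκ0 : 0 ≤ κ := by rw [hκ]; norm_num
  refine ⟨κ, by rw [hκ]; norm_num, D + (m₀ : ℝ) ^ κ, ?_⟩
  intro i m hm
  have hm0 : (0 : ℝ) < m := by exact_mod_cast hm
  have hmκ : 0 < (m : ℝ) ^ κ := Real.rpow_pos_of_pos hm0 κ
  have hm₀κ : 0 ≤ (m₀ : ℝ) ^ κ := Real.rpow_nonneg (Nat.cast_nonneg m₀) κ
  rw [Real.rpow_neg hm0.le, ← div_eq_mul_inv, le_div_iff₀ hmκ]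
  by_cases hsmall : m < m₀
  · -- small scales: `P ≤ 1` and `m^κ ≤ m₀^κ`
    have h1 : (bondPercolation (zdGraph 3) p).real (edgeTwoArms i m) ≤ 1 := measureReal_le_one
    have h2 : (m : ℝ) ^ κ ≤ (m₀ : ℝ) ^ κ :=
      Real.rpow_le_rpow hm0.le (by exact_mod_cast hsmall.le) hκ0
    calc (bondPercolation (zdGraph 3) p).real (edgeTwoArms i m) * (m : ℝ) ^ κ ≤ 1 * (m₀ : ℝ) ^ κ :=
          mul_le_mul h1 h2 hmκ.le zero_le_one
      _ ≤ D + (m₀ : ℝ) ^ κ := by linarith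
  · -- the window `3 n_s ≤ m ≤ 3 n_{s+1}`, `s ≥ 1`
    push Not at hsmall
    rw [hm₀] at hsmall
    obtain ⟨s, hs1, h1, h2⟩ := exists_window (s₀ := 1) hsmall
    set ns := (2 * 2 ^ s + 1) * 2 ^ (55 * s) + 2 ^ s with hns
    set ns' := (2 * 2 ^ (s + 1) + 1) * 2 ^ (55 * (s + 1)) + 2 ^ (s + 1) with hns'
    have hkey := hC s ns hs1 rfl i
    have hns1 : 1 ≤ ns := Nat.one_le_iff_ne_zero.mpr (by positivity)
    have hanti := real_edgeTwoArms_anti p i (m := 3 * ns) (m' := m) (by omega) h1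
    have hsucc : ns' ≤ 2 ^ 57 * ns := nseq_succ_le s
    -- `√m ≤ √3 √(2^57) √n_s`
    have hm' : (m : ℝ) ≤ 3 * (2 ^ 57 * ns) := by
      have : m ≤ 3 * (2 ^ 57 * ns) := h2.trans (Nat.mul_le_mul_left 3 hsucc)
      exact_mod_cast this
    have hsqm : Real.sqrt m ≤ Real.sqrt 3 * Real.sqrt ((2 : ℝ) ^ 57) * Real.sqrt ns := by
      rw [← Real.sqrt_mul (by norm_num), ← Real.sqrt_mul (by positivity)]
      exact Real.sqrt_le_sqrt (by linarith)
    -- `m^{1/112} ≤ (2^61)^{1/112} (√2)^s`, from `m ≤ 2^61 2^{56 s}`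
    obtain ⟨K, hK⟩ : ∃ K : ℕ, K = 2 ^ s := ⟨_, rfl⟩
    obtain ⟨J, hJ⟩ : ∃ J : ℕ, J = 2 ^ (55 * s) := ⟨_, rfl⟩
    have hK2 : 2 ≤ K := by
      rw [hK]
      calc 2 = 2 ^ 1 := rfl
        _ ≤ 2 ^ s := Nat.pow_le_pow_right (by norm_num) hs1
    have hJ2 : 2 ≤ J := by
      rw [hJ]
      calc 2 = 2 ^ 1 := rfl
        _ ≤ 2 ^ (55 * s) := Nat.pow_le_pow_right (by norm_num) (by omega)
    have hJK : J * K = 2 ^ (56 * s) := by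
      rw [hJ, hK, ← pow_add, show 55 * s + s = 56 * s by ring]
    have hnsJK : ns = 2 * (J * K) + J + K := by rw [hns, hJ, hK]; ring
    have hns3 : ns ≤ 3 * (J * K) := by rw [hnsJK]; nlinarith
    have hmle : m ≤ 2 ^ 61 * 2 ^ (56 * s) := by
      rw [← hJK]
      calc m ≤ 3 * (2 ^ 57 * ns) := h2.trans (Nat.mul_le_mul_left 3 hsucc)
        _ ≤ 3 * (2 ^ 57 * (3 * (J * K))) := by gcongr
        _ = 9 * 2 ^ 57 * (J * K) := by ring
        _ ≤ 2 ^ 61 * (J * K) := Nat.mul_le_mul_right (J * K) (by norm_num)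
    have hmler : (m : ℝ) ≤ 2 ^ 61 * 2 ^ (56 * s) := by exact_mod_cast hmle
    have hroot : (m : ℝ) ^ (1 / 112 : ℝ) ≤ ((2 : ℝ) ^ 61) ^ (1 / 112 : ℝ) * Real.sqrt 2 ^ s := by
      rw [← rpow_two_pow_eq_sqrt_two_pow, ← Real.mul_rpow (by positivity) (by positivity)]
      exact Real.rpow_le_rpow hm0.le hmler (by norm_num)
    -- `m^κ = √m · m^{1/112}`
    have hmκ' : (m : ℝ) ^ κ = Real.sqrt m * (m : ℝ) ^ (1 / 112 : ℝ) := by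
      rw [hκ, Real.rpow_add hm0, Real.sqrt_eq_rpow]
    have hpos : 0 ≤ (bondPercolation (zdGraph 3) p).real (edgeTwoArms i (3 * ns)) := measureReal_nonneg
    calc (bondPercolation (zdGraph 3) p).real (edgeTwoArms i m) * (m : ℝ) ^ κ
        ≤ (bondPercolation (zdGraph 3) p).real (edgeTwoArms i (3 * ns)) *
            ((Real.sqrt 3 * Real.sqrt ((2 : ℝ) ^ 57) * Real.sqrt ns) *
              (((2 : ℝ) ^ 61) ^ (1 / 112 : ℝ) * Real.sqrt 2 ^ s)) := by
          rw [hmκ']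
          exact mul_le_mul hanti (mul_le_mul hsqm hroot (by positivity) (by positivity)) (by positivity) hpos
      _ = ((bondPercolation (zdGraph 3) p).real (edgeTwoArms i (3 * ns)) * Real.sqrt ns * Real.sqrt 2 ^ s) *
            (Real.sqrt 3 * Real.sqrt ((2 : ℝ) ^ 57) * ((2 : ℝ) ^ 61) ^ (1 / 112 : ℝ)) := by ring
      _ ≤ C * (Real.sqrt 3 * Real.sqrt ((2 : ℝ) ^ 57) * ((2 : ℝ) ^ 61) ^ (1 / 112 : ℝ)) :=
          mul_le_mul_of_nonneg_right hkey (by positivity)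
      _ = D := by rw [hD]
      _ ≤ D + (m₀ : ℝ) ^ κ := by linarith

end NearLinearTwoClusterDecayCritTwoArm

open NearLinearTwoClusterDecayCritTwoArm in
/-- **Frontier stub W2 (`critTwoArmImproved`) — bond Cerf 2015 Theorem 1.1 AT `p_c(ℤ³)`, unconditional,
qualitative form.**  Given the W1 input `P_{p_c}(a ↔ b inside Λ_{2n}) ≥ c n^{-12}` on `Λ_n²` (in place
of the `θ(p) > 0` connection bound of Cerf's §10), Cerf's §8 inequality in polynomial form
(`cube_mul_real_edgeTwoArms_le_crit`) and one §9 iteration along the dyadic scales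
`n_s = (2·2^s+1) 2^{55 s} + 2^s` (`real_edgeTwoArms_dyadic_le_crit`, AKN seed
`AKN.exists_real_edgeTwoArms_le`) give `P_{p_c}(edgeTwoArms i (3 n_s)) √n_s (√2)^s ≤ C`; monotonicity in
the scale and `n_s`-windows turn this into `P_{p_c}(edgeTwoArms i m) ≤ C' m^{-κ}` with
`κ = 1/2 + 1/112 > 1/2` (`real_edgeTwoArms_le_rpow`; `0 < p_c(ℤ³) < 1` by Grimmett (1.10)).
[cite: Cerf2015, Thm 1.1] -/
theorem stub_critTwoArmImproved :
    (∃ c : ℝ, 0 < c ∧ ∀ n : ℕ, 1 ≤ n → ∀ a ∈ box 3 n, ∀ b ∈ box 3 n,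
      c * (n : ℝ) ^ (-(12 : ℝ)) ≤
        (bondPercolation (zdGraph 3) (criticalProbI 3)).real (openConnIn (↑(box 3 (2 * n)) : Set (Site 3)) a b)) →
    ∃ κ : ℝ, 1 / 2 < κ ∧ ∃ C : ℝ, ∀ i : Fin 3, ∀ m : ℕ, 1 ≤ m →
      (bondPercolation (zdGraph 3) (criticalProbI 3)).real (AKN.edgeTwoArms i m) ≤ C * (m : ℝ) ^ (-κ) := by
  rintro ⟨c, hc, hW⟩
  have hpc := Grimmett1999_criticalProb_pos_lt_one_holds 3 (by norm_num)
  rw [← coe_criticalProbI] at hpc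
  exact real_edgeTwoArms_le_rpow (criticalProbI 3) hpc.1 hpc.2 hc hW

end Summit.CriticalPhenomena.PercolationContinuityZ3.Theorems

end
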